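import Summits.Ventures.LatticeQCDFlow.Scoring.InfiniteVolumeIrreducible2D
import Summits.Ventures.LatticeQCDFlow.Scoring.InfiniteVolumeSUNWilsonLoops2D
import Literature.MathematicalPhysics.QuantumFieldTheory.LatticeGauge
import HarnessLib

/-!
# The exact non-abelian area law in two dimensions, V-o: the S12 facts `exists_hasStaticPotential` / `exists_hasStringTension` IN `d = 2`, for every irreducible representation, `U(N)` and `SU(N)`

HONEST FRAMING: exact (Metropolis-corrected) sampling algorithms for lattice gauge theory;
figures of merit are autocorrelation/cost numbers at stated couplings and volumes; no
continuum-physics claim.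

Venture `LatticeQCDFlow` (cell pub-lqcd), sub-topic `Scoring`; FANOUT row 5 (`s0-sun-a`), GEN-19.
NEW WORK of the cell (placement rule).  The constructive-QFT inventory's S12 named facts
`Literature…LatticeGauge.exists_hasStaticPotential ρ` (transfer-matrix dichotomy: for `β ≥ 0` and every
infinite-volume limit point, either all `W(R,T)`, `T ≥ 1`, vanish or the static potential `V(R) ≥ 0` exists) and
`exists_hasStringTension ρ` (if no loop vanishes, the string tension `σ ≥ 0` exists), stated there for every
`d ≥ 2` (Seiler LNP 159 §2, via reflection positivity), are PROVED HERE IN THE INSTANCE `d = 2` — by exact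
computation, not reflection positivity — for:

* `exists_hasStaticPotential_two_of_irreducible`, `exists_hasStringTension_two_of_irreducible` — every continuous
  representation with trivial commutant (every irreducible one) of every compact metrisable group (`β = 0` or `ρ`
  trivial: the degenerate branches; otherwise `V(R) = −R log P_ρ(β)`, `σ = −log P_ρ(β)`, V-n);
* `exists_hasStaticPotential_two_unitary`, `exists_hasStringTension_two_unitary` — `U(N)`, every `N ≥ 1` (V-l);
* `exists_hasStaticPotential_two_specialUnitary`, `exists_hasStringTension_two_specialUnitary` — `SU(N)`, every
  `N ≥ 1` (`N = 1` is the trivial group; `N ≥ 2` by V-m).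

Tool: `rectExpectation_eq_one_of_forall_eq_one` (the trivial representation has all Wilson loops `= 1`).
No `def`, nothing cited as a fact, 0 sorry.
-/

noncomputable section

open MeasureTheory Function Finset Filter Topology
open Literature.MathematicalPhysics.QuantumFieldTheory
open Literature.MathematicalPhysics.QuantumLattice
open Literature.RepresentationTheory.CompactGroups
open Summit.Ventures.LatticeQCDFlow.Theory2.Lattice
open Summit.Ventures.LatticeQCDFlow.Theory2.Lattice.TwoDim

namespace Summit.Ventures.LatticeQCDFlow.Scoring

section General

variable {G : Type*} [Group G] [TopologicalSpace G] [IsTopologicalGroup G]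
  [CompactSpace G] [T2Space G] [SecondCountableTopology G] [MeasurableSpace G] [BorelSpace G] {N : ℕ}
  (ρ : G →* Matrix (Fin N) (Fin N) ℂ)

omit [T2Space G] [SecondCountableTopology G] in
/-- The trivial representation has all Wilson loops equal to `1` in every infinite-volume limit point. -/
theorem rectExpectation_eq_one_of_forall_eq_one [NeZero N] (hρ1 : ∀ g : G, ρ g = 1) {β : ℝ}
    {μ : Measure (LGConfig 2 G)} (hμ : μ ∈ infiniteVolumeLimitPoints ρ β) (R T : ℕ) :
    rectExpectation μ (fun g => normalisedCharacter N (ρ g)) 0 1 R T = 1 := by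
  obtain ⟨Ls, -, hlim⟩ := hμ
  haveI := hlim.1
  simp [rectExpectation, loopExpectation, wilsonLoopObs, hρ1]

omit [T2Space G] in
/-- **S12 `exists_hasStaticPotential` IN `d = 2`, FOR EVERY REPRESENTATION WITH TRIVIAL COMMUTANT** of every compact
metrisable group: at `β ≥ 0`, for every infinite-volume limit point and every `R ≥ 1`, either all `W(R,T)` (`T ≥ 1`)
vanish (this happens iff `β = 0` and `ρ` is non-trivial) or the static potential exists and is `≥ 0` — indeed
`V(R) = −R log P_ρ(β)` (`ρ` non-trivial, `β > 0`) or `V(R) = 0` (`ρ` trivial). -/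
theorem exists_hasStaticPotential_two_of_irreducible [NeZero N] (hirr : IsIrreducibleFamily fun g : G => ρ g) :
    exists_hasStaticPotential (d := 2) ρ := by
  intro _ hρ _ β hβ μ hμ R hR
  by_cases hnt : ∃ g₀ : G, ρ g₀ ≠ 1
  · rcases hβ.eq_or_lt with hβ0 | hβpos
    · left
      intro T hT
      subst hβ0
      rw [irreducible_rectExpectation_eq ρ hρ hirr 0 hμ hR hT, irreducible_plaquette_zero ρ hρ hirr hnt,
        zero_pow (Nat.mul_ne_zero (by omega) (by omega))]
    · right
      refine ⟨_, ?_, irreducible_hasStaticPotential ρ hρ hirr hnt hβpos.ne' hμ hR⟩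
      have h := (irreducible_plaquette_ne_zero_abs_lt_one ρ hρ hirr hnt hβpos.ne').2
      have h0 := abs_pos.2 (irreducible_plaquette_ne_zero_abs_lt_one ρ hρ hirr hnt hβpos.ne').1
      have hlog : Real.log |(∫ g, (ρ g).trace.re / N * Real.exp (-(β * ((N : ℝ) - (ρ g).trace.re)))
          ∂(haarProbability G)) / (∫ g, Real.exp (-(β * ((N : ℝ) - (ρ g).trace.re))) ∂(haarProbability G))| < 0 :=
        Real.log_neg h0 h
      nlinarith [hlog, (Nat.cast_pos.2 (show 0 < R by omega) : (0 : ℝ) < R)]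
  · push Not at hnt
    right
    refine ⟨-(R * Real.log |(1 : ℝ)|), by simp, ?_⟩
    exact hasStaticPotential_of_rectExpectation_eq_pow one_ne_zero R fun T _ => by
      rw [rectExpectation_eq_one_of_forall_eq_one ρ hnt hμ R T, one_pow]

omit [T2Space G] in
/-- **S12 `exists_hasStringTension` IN `d = 2`, FOR EVERY REPRESENTATION WITH TRIVIAL COMMUTANT**: if no Wilson loop of
the limit state vanishes then the string tension exists and is `≥ 0` — it is `σ = −log P_ρ(β) > 0` (`ρ` non-trivial,
then necessarily `β > 0`) or `σ = 0` (`ρ` trivial). -/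
theorem exists_hasStringTension_two_of_irreducible [NeZero N] (hirr : IsIrreducibleFamily fun g : G => ρ g) :
    exists_hasStringTension (d := 2) ρ := by
  intro _ hρ _ β hβ μ hμ hW
  by_cases hnt : ∃ g₀ : G, ρ g₀ ≠ 1
  · have hβ0 : β ≠ 0 := by
      rintro rfl
      refine hW 1 1 le_rfl le_rfl ?_
      rw [irreducible_rectExpectation_eq ρ hρ hirr 0 hμ le_rfl le_rfl, irreducible_plaquette_zero ρ hρ hirr hnt,
        zero_pow (by norm_num)]
    refine ⟨_, ?_, irreducible_hasStringTension ρ hρ hirr hnt hβ0 hμ⟩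
    have h := (irreducible_plaquette_ne_zero_abs_lt_one ρ hρ hirr hnt hβ0).2
    have h0 := abs_pos.2 (irreducible_plaquette_ne_zero_abs_lt_one ρ hρ hirr hnt hβ0).1
    have hlog := Real.log_neg h0 h
    linarith
  · push Not at hnt
    refine ⟨-Real.log |(1 : ℝ)|, by simp, ?_⟩
    exact hasStringTension_of_rectExpectation_eq_pow one_ne_zero fun R T _ _ => by
      rw [rectExpectation_eq_one_of_forall_eq_one ρ hnt hμ R T, one_pow]

end General

/-! ## `U(N)` and `SU(N)` -/

section Unitary

/-- **S12 `exists_hasStaticPotential` IN `d = 2` FOR `U(N)`, EVERY `N ≥ 1`** (`V(R) = −R log P_N(β)` for `β > 0`; all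
loops vanish at `β = 0`). -/
theorem exists_hasStaticPotential_two_unitary (N : ℕ) [NeZero N] :
    exists_hasStaticPotential (d := 2) (unitaryFundamentalRep (Fin N) ℂ) := by
  intro _ _ _ β hβ μ hμ R hR
  rcases hβ.eq_or_lt with hβ0 | hβpos
  · left
    intro T hT
    subst hβ0
    exact unitary_rectExpectation_eq_zero N hμ hR hT
  · right
    refine ⟨_, ?_, unitary_hasStaticPotential N hβpos.ne' hμ hR⟩
    have h := (unitary_plaquette_ne_zero_abs_lt_one N hβpos.ne').2
    have h0 := abs_pos.2 (unitary_plaquette_ne_zero_abs_lt_one N hβpos.ne').1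
    have hlog := Real.log_neg h0 h
    nlinarith [hlog, (Nat.cast_pos.2 (show 0 < R by omega) : (0 : ℝ) < R)]

/-- **S12 `exists_hasStringTension` IN `d = 2` FOR `U(N)`, EVERY `N ≥ 1`** (`σ = −log P_N(β)`). -/
theorem exists_hasStringTension_two_unitary (N : ℕ) [NeZero N] :
    exists_hasStringTension (d := 2) (unitaryFundamentalRep (Fin N) ℂ) := by
  intro _ _ _ β hβ μ hμ hW
  have hβ0 : β ≠ 0 := by
    rintro rfl
    exact hW 1 1 le_rfl le_rfl (unitary_rectExpectation_eq_zero N hμ le_rfl le_rfl)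
  refine ⟨_, ?_, unitary_hasStringTension N hβ0 hμ⟩
  have h := (unitary_plaquette_ne_zero_abs_lt_one N hβ0).2
  have h0 := abs_pos.2 (unitary_plaquette_ne_zero_abs_lt_one N hβ0).1
  have hlog := Real.log_neg h0 h
  linarith

end Unitary

section SpecialUnitary

/-- `SU(1)` is the trivial group: its fundamental representation is trivial. -/
theorem fundamentalRep_fin_one_eq_one (g : Matrix.specialUnitaryGroup (Fin 1) ℂ) : fundamentalRep (Fin 1) g = 1 := by
  rw [fundamentalRep_apply]
  ext i j
  have hi : i = 0 := Subsingleton.elim _ _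
  have hj : j = 0 := Subsingleton.elim _ _
  subst hi hj
  have hdet := (Matrix.mem_specialUnitaryGroup_iff.mp g.2).2
  rw [Matrix.det_fin_one] at hdet
  rw [Matrix.one_apply_eq]
  exact hdet

/-- **S12 `exists_hasStaticPotential` IN `d = 2` FOR `SU(N)`, EVERY `N ≥ 1`** (`N = 1`: trivial group, `V = 0`; `N ≥ 2`:
`V(R) = −R log P_N(β)` for `β > 0`, all loops vanish at `β = 0`). -/
theorem exists_hasStaticPotential_two_specialUnitary (N : ℕ) [NeZero N] :
    exists_hasStaticPotential (d := 2) (fundamentalRep (Fin N)) := by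
  intro _ _ _ β hβ μ hμ R hR
  obtain hN1 | hN2 : N = 1 ∨ 2 ≤ N := by have := NeZero.pos N; omega
  · subst hN1
    right
    refine ⟨-(R * Real.log |(1 : ℝ)|), by simp, ?_⟩
    exact hasStaticPotential_of_rectExpectation_eq_pow one_ne_zero R fun T _ => by
      rw [rectExpectation_eq_one_of_forall_eq_one (fundamentalRep (Fin 1)) fundamentalRep_fin_one_eq_one hμ R T,
        one_pow]
  · rcases hβ.eq_or_lt with hβ0 | hβpos
    · left
      intro T hT
      subst hβ0
      exact specialUnitary_rectExpectation_eq_zero N hN2 hμ hR hT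
    · right
      refine ⟨_, ?_, specialUnitary_hasStaticPotential N hN2 hβpos.ne' hμ hR⟩
      have h := (specialUnitary_plaquette_ne_zero_abs_lt_one N hN2 hβpos.ne').2
      have h0 := abs_pos.2 (specialUnitary_plaquette_ne_zero_abs_lt_one N hN2 hβpos.ne').1
      have hlog := Real.log_neg h0 h
      nlinarith [hlog, (Nat.cast_pos.2 (show 0 < R by omega) : (0 : ℝ) < R)]

/-- **S12 `exists_hasStringTension` IN `d = 2` FOR `SU(N)`, EVERY `N ≥ 1`** (`σ = 0` for `N = 1`, `σ = −log P_N(β)` for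
`N ≥ 2`). -/
theorem exists_hasStringTension_two_specialUnitary (N : ℕ) [NeZero N] :
    exists_hasStringTension (d := 2) (fundamentalRep (Fin N)) := by
  intro _ _ _ β hβ μ hμ hW
  obtain hN1 | hN2 : N = 1 ∨ 2 ≤ N := by have := NeZero.pos N; omega
  · subst hN1
    refine ⟨-Real.log |(1 : ℝ)|, by simp, ?_⟩
    exact hasStringTension_of_rectExpectation_eq_pow one_ne_zero fun R T _ _ => by
      rw [rectExpectation_eq_one_of_forall_eq_one (fundamentalRep (Fin 1)) fundamentalRep_fin_one_eq_one hμ R T,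
        one_pow]
  · have hβ0 : β ≠ 0 := by
      rintro rfl
      exact hW 1 1 le_rfl le_rfl (specialUnitary_rectExpectation_eq_zero N hN2 hμ le_rfl le_rfl)
    refine ⟨_, ?_, specialUnitary_hasStringTension N hN2 hβ0 hμ⟩
    have h := (specialUnitary_plaquette_ne_zero_abs_lt_one N hN2 hβ0).2
    have h0 := abs_pos.2 (specialUnitary_plaquette_ne_zero_abs_lt_one N hN2 hβ0).1
    have hlog := Real.log_neg h0 h
    linarith

end SpecialUnitary

end Summit.Ventures.LatticeQCDFlow.Scoring
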